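import Mathlib
import Summits.Ventures.PercRepro2.LocRows
import Summits.Ventures.PercRepro2.SwRow
import Summits.Ventures.PercRepro2.SwOut
import Summits.Ventures.PercRepro2.SwAllRow
import Summits.Ventures.PercRepro2.SwOutAll
import Summits.Ventures.PercRepro2.SwOutArmFlip
import Summits.Ventures.PercRepro2.SwOutArmThm
import Summits.Ventures.PercRepro2.SwOutJunction
import Summits.Ventures.PercRepro2.SwOutJunctionRegion
import Summits.Ventures.PercRepro2.SwOutCoreDefs
import Summits.Ventures.PercRepro2.SwOutCoreKey
import Summits.Ventures.PercRepro2.SwOutJunctionH1Defs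
import Summits.Ventures.PercRepro2.SwOutJunctionH1Arms
import Summits.Ventures.PercRepro2.SwOutJunctionH1Cover
import Summits.Ventures.PercRepro2.SwOutJunctionH1Inside
import Summits.Ventures.PercRepro2.SwOutJunctionH1Base
import Summits.Ventures.PercRepro2.SwOutJunctionH1Kinds
import Summits.Ventures.PercRepro2.SwOutBigBlockDefs
import Summits.Ventures.PercRepro2.SwOutMixedBaseDefs
import Summits.Ventures.PercRepro2.SwOutMixedPartDefs

/-!
# The canonical base of a core-kind point of a mixed single junction is a mixed base
(blind cell PercRepro2, night-4 g19, 2026-08-27; proofs/NIGHT4-G19.md §2)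

For a core-kind `Q`-point `ζ` (`u` in the hull of `h`, the hull of `u` inside `U`) of a class
with a mixed single junction (`MixedJunction`, `SwOutMixedPartDefs`), the arm of `p` is the mixed
arm `Ah ∪ {p}` with the non-empty h-piece `AhOf ζ` (by (b) and (e)).  THE DICHOTOMY at the
canonical base `b = coreBaseOf ζ`: when every DEAD EDGE (`p`–`Ah`) is blue at `b`, **`b` is a
`MixedBase`** on the u-arms, the h-piece and the far arms of `ζ` (`mixedBase_of_coreKind`), and
`ζ` is the core point `qOf ζ` of its raw cube (`mixedReal_coreBaseOf`: the flipped classes of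
`qOf ζ` are exactly the edges touching the blue side); when some dead edge is red at `b`, `b` is
a `CoreBase` with the h-arm `Ah ∪ {p}` (the next file).  Every field of the mixed base is one of
the structural lemmas of the (H1) files or of `SwOutMixedPartDefs`: the two sides are disjoint
and not joined by an edge, the arms cover the extended hull and lie on one side, `h` and `u` see
only arms (and `u` sees `p`), `p` sees `u`, its h-piece and the outside, and the arms are
red-connected to `h` inside themselves.
-/

namespace Summit.Ventures.PercRepro2

namespace BigBlock

open Hull LocRows

variable {V : Type*} {E : Type*} [Fintype E] [DecidableEq E]

open scoped Classical

variable {ends : E → Sym2 V}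

section Base

variable {U : Set V} {ξ : Config E} {l h o u p : V}

variable (hj : MixedJunction ends U h u p o)
include hj

/-- **The canonical base of a core-kind `Q`-point with blue dead edges is a mixed base** on the
u-arms, the h-piece and the far arms of the point. -/
theorem mixedBase_of_coreKind (hl : l ∉ U) {ζ : Config E} (hζ : ζ ∈ swOutSide ends l h o U ξ)
    (hk : CoreKind ends U h u ζ)
    (hdead : ∀ e x, ends e = s(p, x) → x ∈ AhOf ends h u p ζ → coreBaseOf ends ζ h u e = false) :
    MixedBase ends (coreBaseOf ends ζ h u) h u p (fun P : uArms ends h u p ζ => P.1)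
      (AhOf ends h u p ζ) (fun P : farArms ends h u p ζ => P.1) := by
  have hhu := hj.hne_hu
  have hdisj : ∀ x, x ∈ redExt ends h u ζ → x ∈ blueExt ends ζ h u → False :=
    fun x hxR hxB => redExt_disjoint_blueExt hl hj.hout hζ hk x hxR hxB
  have hnoRB : ∀ e x y, ends e = s(x, y) → x ∈ redExt ends h u ζ → y ∈ blueExt ends ζ h u →
      False := fun e x y hxy hx hy => no_edge_redExt_blueExt hdisj hxy hx hy
  have hHU : extHull ends ζ h u ⊆ U := extHull_subset_of_coreKind hζ hk
  have hdisj' : ∀ x, x ∈ redExt ends h u (blue ζ) → x ∈ blueExt ends (blue ζ) h u → False := by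
    intro x hxR hxB
    rw [redExt_blue] at hxR
    rw [blueExt_blue] at hxB
    exact hdisj x hxB hxR
  have hAP := armP_mem_armsC hj ζ
  have hAPsub := armsC_subset hAP
  have hpH : p ∈ extHull ends ζ h u := p_mem_extHull hj.hup ζ
  have hpP : p ∈ armC ends h u ζ p := mem_armC_self p
  have hph : p ≠ h := hj.hne_hp.symm
  have hpu : p ≠ u := hj.hne_up.symm
  -- the arm of `p` is neither a u-arm nor a far arm
  have huA : ∀ P : uArms ends h u p ζ, P.1 ≠ armC ends h u ζ p :=
    fun P => (mem_uArms_iff.1 P.2).2.1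
  have hfA : ∀ P : farArms ends h u p ζ, P.1 ≠ armC ends h u ζ p :=
    fun P => (mem_farArms_iff.1 P.2).2.1
  have huF : ∀ (P : uArms ends h u p ζ) (P' : farArms ends h u p ζ), P.1 ≠ P'.1 := by
    intro P P' hPP
    obtain ⟨_, _, hadj⟩ := mem_uArms_iff.1 P.2
    obtain ⟨_, _, hnadj⟩ := mem_farArms_iff.1 P'.2
    exact hnadj (hPP ▸ hadj)
  have hmemU := fun P : uArms ends h u p ζ => (mem_uArms_iff.1 P.2).1
  have hmemF := fun P : farArms ends h u p ζ => (mem_farArms_iff.1 P.2).1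
  -- a vertex of the extended hull outside every arm and `h, u, p` does not exist
  have hcover : ∀ x ∈ extHull ends ζ h u, x ≠ h → x ≠ u → x ≠ p →
      x ∈ armsAll (fun P : uArms ends h u p ζ => P.1) (AhOf ends h u p ζ)
        (fun P : farArms ends h u p ζ => P.1) := by
    intro x hxH hxh hxu hxp
    rcases arm_cases hj hxH hxh hxu with hx | hx | ⟨P, hP, hx⟩ | ⟨P, hP, hx⟩
    · exact Or.inl (Or.inr hx)
    · exact absurd hx hxp
    · exact Or.inl (Or.inl (Set.mem_iUnion.2 ⟨⟨P, hP⟩, hx⟩))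
    · exact Or.inr (Set.mem_iUnion.2 ⟨⟨P, hP⟩, hx⟩)
  -- the dead edges at `ζ`: on the red side they keep their colour, on the blue side they flip
  exact
  { hne_hu := hhu
    hne_hp := hj.hne_hp
    hne_up := hj.hne_up
    h_notMem_U := fun P hh => (armsC_subset (hmemU P) h hh).2.1 rfl
    u_notMem_U := fun P hu => (armsC_subset (hmemU P) u hu).2.2 rfl
    p_notMem_U := fun P hp => armsC_disjoint (hmemU P) hAP (huA P) p hp hpP
    h_notMem_Ah := fun hh => (hAPsub h hh.1).2.1 rfl
    u_notMem_Ah := fun hu => (hAPsub u hu.1).2.2 rfl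
    p_notMem_Ah := fun hp => hp.2 rfl
    h_notMem_F := fun P hh => (armsC_subset (hmemF P) h hh).2.1 rfl
    u_notMem_F := fun P hu => (armsC_subset (hmemF P) u hu).2.2 rfl
    p_notMem_F := fun P hp => armsC_disjoint (hmemF P) hAP (hfA P) p hp hpP
    U_disj := fun P P' hne x hx =>
      armsC_disjoint (hmemU P) (hmemU P') (fun h' => hne (Subtype.ext h')) x hx
    U_disj_Ah := fun P x hx hxA => armsC_disjoint (hmemU P) hAP (huA P) x hx hxA.1
    U_disj_F := fun P P' x hx => armsC_disjoint (hmemU P) (hmemF P') (huF P P') x hx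
    Ah_disj_F := fun P' x hx => armsC_disjoint hAP (hmemF P') (fun h' => hfA P' h'.symm) x hx.1
    F_disj := fun P P' hne x hx =>
      armsC_disjoint (hmemF P) (hmemF P') (fun h' => hne (Subtype.ext h')) x hx
    U_nonempty := fun P => armsC_nonempty (hmemU P)
    Ah_nonempty := by
      obtain ⟨e, y, hey, hyU, hyu⟩ := hj.hp_nbr
      obtain ⟨e', hye⟩ := hj.hp_adj_h e y hey hyU hyu
      have hyh : y ≠ h := by
        rintro rfl
        exact hj.hnadj_p e (ends_swap hey)
      have hyp : y ≠ p := by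
        rintro rfl
        exact hj.hloop_p e hey
      have hyH : y ∈ extHull ends ζ h u := by
        cases hc : ζ e' with
        | true =>
          exact Or.inl (Or.inl (mem_cluster_of_edge (mem_cluster_self _ _ _) hc (ends_swap hye)))
        | false =>
          have hc' : blue ζ e' = true := by rw [blue_eq_true_iff]; exact hc
          exact Or.inl (Or.inr (mem_cluster_of_edge (mem_cluster_self _ _ _) hc' (ends_swap hye)))
      exact ⟨y, mem_armC_of_edge hpP hpH hph hpu hyH hyh hyu hey, hyp⟩
    F_nonempty := fun P => armsC_nonempty (hmemF P)
    no_cross_UU := fun P P' hne e x y hxy hx hy =>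
      armsC_no_cross (hmemU P) (hmemU P') (fun h' => hne (Subtype.ext h')) hxy hx hy
    no_cross_UAh := fun P e x y hxy hx hy => armsC_no_cross (hmemU P) hAP (huA P) hxy hx hy.1
    no_cross_UF := fun P P' e x y hxy hx hy =>
      armsC_no_cross (hmemU P) (hmemF P') (huF P P') hxy hx hy
    no_cross_AhF := fun P' e x y hxy hx hy =>
      armsC_no_cross hAP (hmemF P') (fun h' => hfA P' h'.symm) hxy hx.1 hy
    no_cross_FF := fun P P' hne e x y hxy hx hy =>
      armsC_no_cross (hmemF P) (hmemF P') (fun h' => hne (Subtype.ext h')) hxy hx hy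
    h_edges := by
      intro e x hxe
      have hxh : x ≠ h := fun h' => hj.hloop_h e (by rw [hxe, h'])
      have hxu : x ≠ u := fun h' => hj.hnadj e (by rw [hxe, h'])
      have hxp : x ≠ p := fun h' => hj.hnadj_p e (by rw [hxe, h'])
      have hxH : x ∈ extHull ends ζ h u := by
        cases he : ζ e with
        | true => exact Or.inl (Or.inl (mem_cluster_of_edge (mem_cluster_self _ _ _) he hxe))
        | false =>
          have he' : blue ζ e = true := by rw [blue_eq_true_iff]; exact he
          exact Or.inl (Or.inr (mem_cluster_of_edge (mem_cluster_self _ _ _) he' hxe))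
      rcases hcover x hxH hxh hxu hxp with (hx | hx) | hx
      · obtain ⟨P, hP⟩ := Set.mem_iUnion.1 hx
        exact Or.inl ⟨P, hP⟩
      · exact Or.inr (Or.inl hx)
      · obtain ⟨P, hP⟩ := Set.mem_iUnion.1 hx
        exact Or.inr (Or.inr ⟨P, hP⟩)
    u_edges := by
      intro e x hxe
      have hxu : x ≠ u := fun h' => hj.hloop_u e (by rw [hxe, h'])
      have hxh : x ≠ h := fun h' => hj.hnadj e (by rw [hxe, h', Sym2.eq_swap])
      by_cases hxp : x = p
      · exact Or.inr hxp
      have hxH : x ∈ extHull ends ζ h u := by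
        cases he : ζ e with
        | true => exact Or.inr (Or.inl (mem_cluster_of_edge (mem_cluster_self _ _ _) he hxe))
        | false =>
          have he' : blue ζ e = true := by rw [blue_eq_true_iff]; exact he
          exact Or.inr (Or.inr (mem_cluster_of_edge (mem_cluster_self _ _ _) he' hxe))
      obtain ⟨P, hP, hxP⟩ := exists_armsC_of_mem hhu hxH hxh hxu
      have hPp : P ≠ armC ends h u ζ p := by
        rintro rfl
        exact hxp (eq_p_of_u_edge hj hHU hxe hxP)
      refine Or.inl ⟨⟨P, ?_⟩, hxP⟩
      exact mem_uArms_iff.2 ⟨hP, hPp, e, x, hxe, hxP⟩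
    p_edges := by
      intro e x hxe
      have hxp : x ≠ p := fun h' => hj.hloop_p e (by rw [hxe, h'])
      have hxh : x ≠ h := fun h' => hj.hnadj_p e (by rw [hxe, h', Sym2.eq_swap])
      by_cases hxu : x = u
      · exact Or.inl hxu
      by_cases hxH : x ∈ extHull ends ζ h u
      · exact Or.inr (Or.inl ⟨mem_armC_of_edge hpP hpH hph hpu hxH hxh hxu hxe, hxp⟩)
      · refine Or.inr (Or.inr ⟨hxh, hxp, fun hx => hxH (mem_extHull_of_mem_armsAll hj hx).1⟩)
    u_adj_U := fun P => (mem_uArms_iff.1 P.2).2.2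
    h_red := by
      intro e x hxe
      have hxh : x ≠ h := fun h' => hj.hloop_h e (by rw [hxe, h'])
      have hxu : x ≠ u := fun h' => hj.hnadj e (by rw [hxe, h'])
      cases he : ζ e with
      | true =>
        have hxR : x ∈ redExt ends h u ζ := by
          rw [mem_redExt_iff]
          exact ⟨Or.inl (mem_cluster_of_edge (mem_cluster_self _ _ _) he hxe), hxh, hxu⟩
        rw [coreBaseOf_apply_of_notMem hxe h_notMem_blueExt (fun h' => hdisj x hxR h'), he]
      | false =>
        have he' : blue ζ e = true := by rw [blue_eq_true_iff]; exact he
        have hxB : x ∈ blueExt ends ζ h u := by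
          rw [mem_blueExt_iff]
          exact ⟨Or.inl (mem_cluster_of_edge (mem_cluster_self _ _ _) he' hxe), hxh, hxu⟩
        rw [coreBaseOf_apply_of_mem (ends_swap hxe) hxB, he]
        rfl
    u_red := by
      intro e x hxe
      have hxu : x ≠ u := fun h' => hj.hloop_u e (by rw [hxe, h'])
      have hxh : x ≠ h := fun h' => hj.hnadj e (by rw [hxe, h', Sym2.eq_swap])
      cases he : ζ e with
      | true =>
        have hxR : x ∈ redExt ends h u ζ := by
          rw [mem_redExt_iff]
          exact ⟨Or.inr (mem_cluster_of_edge (mem_cluster_self _ _ _) he hxe), hxh, hxu⟩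
        rw [coreBaseOf_apply_of_notMem hxe u_notMem_blueExt (fun h' => hdisj x hxR h'), he]
      | false =>
        have he' : blue ζ e = true := by rw [blue_eq_true_iff]; exact he
        have hxB : x ∈ blueExt ends ζ h u := by
          rw [mem_blueExt_iff]
          exact ⟨Or.inr (mem_cluster_of_edge (mem_cluster_self _ _ _) he' hxe), hxh, hxu⟩
        rw [coreBaseOf_apply_of_mem (ends_swap hxe) hxB, he]
        rfl
    dead_blue := fun e x hxe hx => hdead e x hxe hx
    ext_blue := by
      intro e x hxe hxu hxA
      have hxp : x ≠ p := fun h' => hj.hloop_p e (by rw [hxe, h'])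
      have hxh : x ≠ h := fun h' => hj.hnadj_p e (by rw [hxe, h', Sym2.eq_swap])
      have hxH : x ∉ extHull ends ζ h u := fun hxH =>
        hxA ⟨mem_armC_of_edge hpP hpH hph hpu hxH hxh hxu hxe, hxp⟩
      exact coreBaseOf_bdry_blue hdisj hxe hpH hxH
    bdry_blue := by
      intro e x y hxy hx hyh hyu hyp hy
      have hxH := (mem_extHull_of_mem_armsAll hj hx).1
      have hyH : y ∉ extHull ends ζ h u := fun hyH => hy (hcover y hyH hyh hyu hyp)
      exact coreBaseOf_bdry_blue hdisj hxy hxH hyH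
    U_conn := by
      intro P x hx
      have hP := hmemU P
      have hPu : ∀ e y, ends e = s(u, y) → y ∈ P.1 → ∃ e', ends e' = s(y, h) := by
        intro e y hey hyP
        refine hj.hu_adj_h e y hey ?_
        intro hyp
        exact armsC_disjoint (hmemU P) hAP (huA P) y hyP (hyp ▸ hpP)
      rcases armsC_subset_side hnoRB hP with hPR | hPB
      · rw [insideConfig_coreBaseOf_of_subset_red hPR (Or.inl rfl) hdisj]
        exact harm_conn_red' hdisj hP hPR hPu x hx
      · rw [insideConfig_coreBaseOf_of_subset_blue hPB hj.hloop_h]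
        have hP' : P.1 ∈ armsC ends h u (blue ζ) := by rw [armsC_blue]; exact hP
        have hPR' : P.1 ⊆ redExt ends h u (blue ζ) := by rw [redExt_blue]; exact hPB
        exact harm_conn_red' hdisj' hP' hPR' hPu x hx
    Ah_conn := by
      intro x hx
      have hno_u : ∀ e y, ends e = s(u, y) → y ∈ armC ends h u ζ p → y = p :=
        fun e y hey hy => eq_p_of_u_edge hj hHU hey hy
      rcases armsC_subset_side hnoRB hAP with hPR | hPB
      · have hAR : AhOf ends h u p ζ ⊆ redExt ends h u ζ := fun y hy => hPR hy.1
        rw [insideConfig_coreBaseOf_of_subset_red hAR (Or.inl rfl) hdisj]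
        refine Ah_conn_red hAP hPR hno_u ?_ x hx
        intro e y hey hy hyp
        rw [← hdead e y hey ⟨hy, hyp⟩]
        exact (coreBaseOf_apply_of_notMem hey (fun h' => hdisj p (hPR hpP) h')
          (fun h' => hdisj y (hPR hy) h')).symm
      · have hAB : AhOf ends h u p ζ ⊆ blueExt ends ζ h u := fun y hy => hPB hy.1
        rw [insideConfig_coreBaseOf_of_subset_blue hAB hj.hloop_h]
        have hAP' : armC ends h u (blue ζ) p ∈ armsC ends h u (blue ζ) := by
          rw [armsC_blue, armC_eq_of_extHull_eq extHull_blue]; exact hAP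
        have hPR' : armC ends h u (blue ζ) p ⊆ redExt ends h u (blue ζ) := by
          rw [redExt_blue, armC_eq_of_extHull_eq extHull_blue]; exact hPB
        have hno_u' : ∀ e y, ends e = s(u, y) → y ∈ armC ends h u (blue ζ) p → y = p := by
          intro e y hey hy
          rw [armC_eq_of_extHull_eq extHull_blue] at hy
          exact hno_u e y hey hy
        have hdead' : ∀ e y, ends e = s(p, y) → y ∈ armC ends h u (blue ζ) p → y ≠ p →
            blue ζ e = false := by
          intro e y hey hy hyp
          rw [armC_eq_of_extHull_eq extHull_blue] at hy
          rw [← hdead e y hey ⟨hy, hyp⟩, coreBaseOf_apply_of_mem hey (hPB hpP)]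
          rfl
        have key := Ah_conn_red hAP' hPR' hno_u' hdead' x
          (by rw [armC_eq_of_extHull_eq extHull_blue]; exact hx)
        rw [armC_eq_of_extHull_eq extHull_blue] at key
        exact key
    F_conn := by
      intro P x hx
      have hP := hmemF P
      have hPu : ∀ e y, ends e = s(u, y) → y ∈ P.1 → ∃ e', ends e' = s(y, h) := by
        intro e y hey hyP
        exact absurd ⟨e, y, hey, hyP⟩ (mem_farArms_iff.1 P.2).2.2
      rcases armsC_subset_side hnoRB hP with hPR | hPB
      · rw [insideConfig_coreBaseOf_of_subset_red hPR (Or.inl rfl) hdisj]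
        exact harm_conn_red' hdisj hP hPR hPu x hx
      · rw [insideConfig_coreBaseOf_of_subset_blue hPB hj.hloop_h]
        have hP' : P.1 ∈ armsC ends h u (blue ζ) := by rw [armsC_blue]; exact hP
        have hPR' : P.1 ⊆ redExt ends h u (blue ζ) := by rw [redExt_blue]; exact hPB
        exact harm_conn_red' hdisj' hP' hPR' hPu x hx }

/-- **A core-kind point is the realisation of the cube point of its canonical base** given by
its red arms (the mixed arm giving `a = uP = e`). -/
theorem mixedReal_coreBaseOf (hl : l ∉ U) {ζ : Config E} (hζ : ζ ∈ swOutSide ends l h o U ξ)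
    (hk : CoreKind ends U h u ζ) :
    mixedReal ends u p (fun P : uArms ends h u p ζ => P.1) (AhOf ends h u p ζ)
      (fun P : farArms ends h u p ζ => P.1) (coreBaseOf ends ζ h u) (qOf ends h u p ζ) = ζ := by
  have hhu := hj.hne_hu
  have hdisj : ∀ x, x ∈ redExt ends h u ζ → x ∈ blueExt ends ζ h u → False :=
    fun x hxR hxB => redExt_disjoint_blueExt hl hj.hout hζ hk x hxR hxB
  have hnoRB : ∀ e x y, ends e = s(x, y) → x ∈ redExt ends h u ζ → y ∈ blueExt ends ζ h u →
      False := fun e x y hxy hx hy => no_edge_redExt_blueExt hdisj hxy hx hy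
  have hAP := armP_mem_armsC hj ζ
  have hpH : p ∈ extHull ends ζ h u := p_mem_extHull hj.hup ζ
  have hpP : p ∈ armC ends h u ζ p := mem_armC_self p
  have hph : p ≠ h := hj.hne_hp.symm
  have hpu : p ≠ u := hj.hne_up.symm
  -- an arm is on the blue side iff it is not on the red side
  have hside : ∀ P ∈ armsC ends h u ζ, ¬ P ⊆ redExt ends h u ζ ↔ P ⊆ blueExt ends ζ h u := by
    intro P hP
    obtain ⟨y, hy⟩ := armsC_nonempty hP
    constructor
    · intro hnot
      rcases armsC_subset_side hnoRB hP with hPR | hPB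
      · exact absurd hPR hnot
      · exact hPB
    · intro hPB hPR
      exact hdisj y (hPR hy) (hPB hy)
  -- the flipped classes of `qOf ζ` are exactly the edges touching the blue side
  have key : ∀ e, e ∈ flipSet ends u p (fun P : uArms ends h u p ζ => P.1) (AhOf ends h u p ζ)
      (fun P : farArms ends h u p ζ => P.1) (qOf ends h u p ζ) ↔
      e ∈ touches ends (blueExt ends ζ h u) := by
    intro e
    constructor
    · rintro ((((⟨P, hP, x, hx, y, hxy⟩ | ⟨hA, x, hx, y, hxy⟩) | ⟨hc, hup⟩) | ⟨hc, z, hpz, _, _⟩) |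
        ⟨P, hP, x, hx, y, hxy⟩)
      · simp only [qOf, decide_eq_false_iff_not] at hP
        exact ⟨x, ((hside P.1 (mem_uArms_iff.1 P.2).1).1 hP) hx, y, hxy⟩
      · simp only [qOf, decide_eq_false_iff_not] at hA
        exact ⟨x, ((hside _ hAP).1 hA) hx.1, y, hxy⟩
      · simp only [qOf, decide_eq_false_iff_not] at hc
        exact ⟨p, ((hside _ hAP).1 hc) hpP, u, ends_swap hup⟩
      · simp only [qOf, decide_eq_false_iff_not] at hc
        exact ⟨p, ((hside _ hAP).1 hc) hpP, z, hpz⟩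
      · simp only [qOf, decide_eq_false_iff_not] at hP
        exact ⟨x, ((hside P.1 (mem_farArms_iff.1 P.2).1).1 hP) hx, y, hxy⟩
    · rintro ⟨x, hxB, y, hxy⟩
      have hxH := blueExt_subset_extHull hxB
      obtain ⟨_, hxh, hxu⟩ := mem_blueExt_iff.1 hxB
      obtain ⟨P, hP, hxP⟩ := exists_armsC_of_mem hhu hxH hxh hxu
      have hnotR : ¬ P ⊆ redExt ends h u ζ := fun hPR => hdisj x (hPR hxP) hxB
      by_cases hPp : P = armC ends h u ζ p
      · subst hPp
        have hc : decide (armC ends h u ζ p ⊆ redExt ends h u ζ) = false := by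
          simp only [decide_eq_false_iff_not]; exact hnotR
        by_cases hxp : x = p
        · rw [hxp] at hxy
          by_cases hyu : y = u
          · subst hyu
            exact Or.inl (Or.inl (Or.inr ⟨hc, ends_swap hxy⟩))
          by_cases hyA : y ∈ AhOf ends h u p ζ
          · exact Or.inl (Or.inl (Or.inl (Or.inr ⟨hc, y, hyA, p, ends_swap hxy⟩)))
          · exact Or.inl (Or.inr ⟨hc, y, hxy, hyu, hyA⟩)
        · exact Or.inl (Or.inl (Or.inl (Or.inr ⟨hc, x, ⟨hxP, hxp⟩, y, hxy⟩)))
      by_cases hadj : ∃ e x, ends e = s(u, x) ∧ x ∈ P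
      · have hPu : P ∈ uArms ends h u p ζ := mem_uArms_iff.2 ⟨hP, hPp, hadj⟩
        refine Or.inl (Or.inl (Or.inl (Or.inl ⟨⟨P, hPu⟩, ?_, x, hxP, y, hxy⟩)))
        simp only [qOf, decide_eq_false_iff_not]; exact hnotR
      · have hPf : P ∈ farArms ends h u p ζ := mem_farArms_iff.2 ⟨hP, hPp, hadj⟩
        refine Or.inr ⟨⟨P, hPf⟩, ?_, x, hxP, y, hxy⟩
        simp only [qOf, decide_eq_false_iff_not]; exact hnotR
  funext e
  unfold mixedReal coreBaseOf
  by_cases he : e ∈ touches ends (blueExt ends ζ h u)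
  · rw [if_pos ((key e).2 he), flip_apply_of_mem he, Bool.not_not]
  · rw [if_neg (fun h' => he ((key e).1 h')), flip_apply_of_notMem he]

end Base

end BigBlock

end Summit.Ventures.PercRepro2
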